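import Literature.Computability.Complexity.IKWSimulationMachine
import Literature.Computability.Complexity.IKWGenMachine
import HarnessLib

/-!
# IKW 2002, Theorem 12 (2): correctness of the nondeterministic simulation of `MA`, the class-level
# assembly from the discrete Theorem 11, and the discharge `IKW2002_thm12_2_holds`

Literature / circuit complexity — derandomization. Sibling proof file of `IKWGenerators.lean` (named
facts `IKW2002_thm12_1/2`: Impagliazzo–Kabanets–Wigderson 2002, Thm. 12) and sequel of
`IKWSimulationMachine.lean` (the verifier `IKWSim.exists_verifier` and its language
`IKWSim.simLang ∈ NTIME(2^{⌈M^ε⌉₊})`). The printed proof of Theorem 12 is "Theorem 11 readily implies the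
following"; accordingly this file PROVES

* **`IKW2002_thm12_2_of_thm11`** — `IKW2002_thm12_2` (for monotone advice bounds `a`, a `poly(2ⁿ)`-time
  nondeterministic generator of `2ⁿ`-bit truth tables with advice `a(n)` that are superpolynomially
  hard infinitely often gives `MA ⊆ io-[NTIME(2^{N^ε})/a(N^ε)]` for every `ε > 0`) FROM the discrete
  reading of IKW's Theorem 11 ([BFNW93, KM99]) recorded in `HardnessVsRandomness.lean`: *there are
  `F ∈ FP` and `c` such that for all `m, n` and every `f : {0,1}^m → {0,1}` with
  `(n + m)^c < circuitSizeOver B2 f`, `IsSizePseudorandom (tableGenerator F f (c·m^{sx}) n)`* for some `sx ≥ 1` (the record has `sx = 2`;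
  the construction reachable with the tree's algebraic designs gives `sx = 4`) — taken here as an
  explicit HYPOTHESIS (it is not vendored as a named fact, D-0026; its inline proof — worst-case
  to average-case hardness amplification, the Nisan–Wigderson generator with its circuit-size
  bookkeeping, and an `FP` implementation of `F` driven by the table — is
  `IKWTableGenerator.lean` + `IKWExtTable.lean` + `IKWGenMachine.lean`);
* **`IKW2002_thm11_tableGenerator`** — that hypothesis, PROVED with `sx = 4`: the `FP` machine of
  `IKWGenM.exists_FP_tableGenerator_eq_genPad` computes `IKWGen.genPad`, which is `SIZE(n)`-pseudorandom
  for tables of circuit complexity `> (n + m)^{c₀}` (`IKWGen.exists_hardness_exponent`);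
* **`IKW2002_thm12_2_holds : IKW2002_thm12_2`** — the discharge of the named fact of `IKWGenerators.lean`.

The steps (all proved):

* `IKWSim.card_seeds_eq_accCount` — the machine's count of accepting seeds IS the number of seeds
  `s ∈ {0,1}^{c m^{sx}}` on which Arthur's circuit accepts the generator's output (the seeds
  `ρᵢ = takeD (c m^{sx}) (bin i)`, `i < 2^{c m^{sx}}`, enumerate `{0,1}^{c m^{sx}}` once each);
* `IKWSim.abs_accCount_sub_le` — **the fooling step**: at a length whose scale `m` is `d`-hard for the
  generator and meets the threshold `(n + m)^c ≤ m^d`, every GENERATED table is the truth table of a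
  function of circuit complexity `> (n+m)^c`, so `G_t` is `SIZE(n)`-pseudorandom and Arthur's circuit
  (size `≤ n`, reading `mv(N) ≤ n` coins; `MATests.exists_circuit`, `HardnessVsRandomnessTests.lean`)
  accepts a fraction of the seeds within `1/n` of its acceptance probability;
* `IKWSim.verdictBit_eq_false` / `IKWSim.verdictBit_eq_true` — soundness (value `≤ 1/3`: every witness
  is rejected, since `1/3 + 1/n < 1/2` for `n ≥ 7`) and completeness (some message is accepted with
  probability `≥ 2/3`; the honest witness `⟨y, g₀⟩` with an accepting guess `g₀` of the generator is kept
  whole by the truncation and gives `2/3 − 1/n > 1/2`) at the good lengths;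
* the assembly: the root depth `j` with `sx·2^{-j} < ε` (`exists_root_depth`), the output length
  `Nb = q(2N + 2 mv) + mv + 7`, the advice `N ↦ adv(m(N))` of length `≤ c_G a(⌈N^ε⌉₊) + c_G` (monotone
  `a`, `m(N) ≤ ⌈N^ε⌉₊`), the good lengths (`HardIO` transported along the surjection `N ↦ m(N)`,
  `IKWScales.lean`, intersected with the eventual threshold and cost bounds), and admissibility of the
  honest witness (`IKWSim.exists_keptLen_le`).

No definitions; nothing is asserted. Mathlib has no complexity classes; nothing duplicates the tree
(searched `thm12_2_of`, `accCount_sub`, `verdictBit_eq`).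

## References

* R. Impagliazzo, V. Kabanets, A. Wigderson, *In search of an easy witness: exponential time vs.
  probabilistic polynomial time*, JCSS 65 (2002) 672–694, §2.4, Thm. 11, Thm. 12 (2) and the paragraph
  before it [ImpagliazzoKabanetsWigderson2002] (held text `paper:doi-10-1016-s0022-0000-02-00024-7`,
  pp. 7–8, checked).
* O. Goldreich, D. Zuckerman, *Another proof that BPP ⊆ PH (and more)*, ECCC TR97-045 (1997) (the
  nondeterministic simulation of `MA`; cited through IKW §2.4).
* S. Arora, B. Barak, *Computational Complexity: A Modern Approach*, CUP 2009, proofs of Lemma 20.3 and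
  Lemma 20.20 [AroraBarakCC2009].
-/

noncomputable section

namespace Literature.Computability.Complexity

open _root_.Computability Turing Finset Filter Polynomial Brick Plumb

namespace IKWSim

/-! ### Correctness at the good lengths -/

section Correct

variable {a : ℕ → ℕ} (G : TruthTableGenerator a) (Ref : Language Bool) (F : List Bool → List Bool)
  (mv Nb : Polynomial ℕ) (c sx j : ℕ)

/-- **The pseudorandom acceptance count**: for Arthur's circuit `C` at `(x, y)` (value
`[⟨x, enc (y, r↾m')⟩ ∈ Ref]`) and the generator `G_f` of the table `t = truthTable f`, the seeds
`s ∈ {0,1}^k` with `C(G_f(s)) = 1` are counted by `accCount` (the seeds `ρᵢ`, `i < 2^k`, enumerate `{0,1}^k`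
once each). [cite: AroraBarakCC2009, Lemma 20.3 (proof)] -/
theorem card_seeds_eq_accCount (x y : List Bool) {M : ℕ} (f : (Fin M → Bool) → Bool) {n m' k : ℕ}
    (hm'n : m' ≤ n) (hm' : m' = mv.eval x.length) (hn : n = Nb.eval x.length)
    (hk : k = seedLen c sx j x.length) (C : Circuit (Fin n))
    (hC : ∀ r, C.eval r = Ref.boolIndicator
      (boolPair x (encMoves [y, List.ofFn fun i : Fin m' => r (Fin.castLE hm'n i)]))) :
    #{s : Fin k → Bool | C.eval (tableGenerator F f k n s) = true} =
      accCount Ref F mv Nb c sx j x y (MetaComplexity.truthTable f) := by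
  classical
  subst hm' hn hk
  set E : Set (List Bool) := {σ | boolPair x (encMoves [y, List.takeD (mv.eval x.length)
    (F (boolPair (MetaComplexity.truthTable f) (boolPair (ones (Nb.eval x.length)) σ))) false]) ∈ Ref} with hE
  have h1 : accCount Ref F mv Nb c sx j x y (MetaComplexity.truthTable f) = cnt (seedLen c sx j x.length) E := by
    rw [accCount, ← CoinEnum.sum_range_ite_natBits]
    refine Finset.sum_congr rfl fun i hi => ?_
    rw [PRGDerand.takeD_encodeNat_eq_natBits (Finset.mem_range.1 hi)]
    by_cases h : natBits (seedLen c sx j x.length) i ∈ E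
    · rw [if_pos h, (Set.mem_iff_boolIndicator _ _).1 (show _ ∈ Ref from h)]; rfl
    · rw [if_neg h, (Set.notMem_iff_boolIndicator _ _).1 (show _ ∉ Ref from h)]; rfl
  rw [h1, ← card_filter_ofFn_mem_eq_cnt]
  refine congrArg Finset.card (Finset.filter_congr fun s _ => ?_)
  rw [hC, ← Set.mem_iff_boolIndicator]
  have e : (List.ofFn fun i : Fin (mv.eval x.length) =>
      tableGenerator F f (seedLen c sx j x.length) (Nb.eval x.length) s (Fin.castLE hm'n i)) =
      List.takeD (mv.eval x.length) (F (boolPair (MetaComplexity.truthTable f)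
        (boolPair (ones (Nb.eval x.length)) (List.ofFn s)))) false := by
    rw [← ofFn_getD_eq_takeD]
    simp [tableGenerator, OracleCompose.unaryEncodeNat_eq_replicate, ones]
  rw [e]
  rfl

variable {G Ref F mv Nb c sx j}

/-- **The fooling step**: at a length `N = |x|` whose scale `m` is `d`-hard for the generator, with the
threshold of Theorem 11 met (`(n + m)^c ≤ m^d`, `n = Nb(N) ≥ 7`) and Arthur's circuits of size `≤ n` reading
`mv(N) ≤ n` coins, every GENERATED table `t` makes the seed count of any message `y` agree with Arthur's
acceptance probability within `1/n`. [cite: ImpagliazzoKabanetsWigderson2002, Thm. 12 (proof)] -/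
theorem abs_accCount_sub_le
    (h11 : ∀ (m n : ℕ) (f : (Fin m → Bool) → Bool), (n + m) ^ c < circuitSizeOver B2 f →
      IsSizePseudorandom (tableGenerator F f (c * m ^ sx) n))
    (x y t : List Bool) {d : ℕ} (hhard : G.HardAt ((Nat.sqrt^[j] x.length) ^ d) (Nat.sqrt^[j] x.length))
    (ht : t ∈ G.outputs (Nat.sqrt^[j] x.length))
    (hthr : (Nb.eval x.length + Nat.sqrt^[j] x.length) ^ c ≤ (Nat.sqrt^[j] x.length) ^ d)
    (hmvn : mv.eval x.length ≤ Nb.eval x.length)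
    (C : Circuit (Fin (Nb.eval x.length))) (hB : C.IsOver B2) (hs : C.size ≤ Nb.eval x.length)
    (hC : ∀ r, C.eval r = Ref.boolIndicator
      (boolPair x (encMoves [y, List.ofFn fun i : Fin (mv.eval x.length) => r (Fin.castLE hmvn i)]))) :
    |(accCount Ref F mv Nb c sx j x y t : ℝ) / 2 ^ seedLen c sx j x.length -
        uniformProb (mv.eval x.length) {z | boolPair x (encMoves [y, z]) ∈ Ref}| ≤
      1 / ((Nb.eval x.length : ℕ) : ℝ) := by
  -- the table is the truth table of a hard function
  have hlen : t.length = 2 ^ Nat.sqrt^[j] x.length := G.length_of_mem_outputs ht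
  have htf : t = MetaComplexity.truthTable (MetaComplexity.ofTruthTable t hlen) :=
    (MetaComplexity.truthTable_ofTruthTable t hlen).symm
  have hcs : (Nb.eval x.length + Nat.sqrt^[j] x.length) ^ c <
      circuitSizeOver B2 (MetaComplexity.ofTruthTable t hlen) := hthr.trans_lt (hhard t ht _ htf)
  have hadv := h11 _ _ _ hcs C hB hs
  unfold MetaComplexity.prgAdvantage at hadv
  rw [card_seeds_eq_accCount Ref F mv Nb c sx j x y (MetaComplexity.ofTruthTable t hlen) hmvn rfl rfl rfl C hC,
    MATests.card_random_eq_uniformProb Ref x y hmvn C hC, ← htf] at hadv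
  exact hadv

/-- **Soundness at a good length**: if `x ∉ L` (every message of Merlin is accepted with probability
`≤ 1/3`) then the verifier rejects EVERY witness on `⟨x, adv m⟩`.
[cite: ImpagliazzoKabanetsWigderson2002, Thm. 12 (proof)] -/
theorem verdictBit_eq_false
    (h11 : ∀ (m n : ℕ) (f : (Fin m → Bool) → Bool), (n + m) ^ c < circuitSizeOver B2 f →
      IsSizePseudorandom (tableGenerator F f (c * m ^ sx) n))
    {q : Polynomial ℕ}
    (hq : ∀ (x y : List Bool) (m' N' : ℕ) (hmN : m' ≤ N'),
      ∃ C : Circuit (Fin N'), C.IsOver B2 ∧ C.size ≤ q.eval (2 * x.length + y.length + m') ∧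
        ∀ r, C.eval r = Ref.boolIndicator
          (boolPair x (encMoves [y, List.ofFn fun i : Fin m' => r (Fin.castLE hmN i)])))
    (x : List Bool) {d : ℕ} (hhard : G.HardAt ((Nat.sqrt^[j] x.length) ^ d) (Nat.sqrt^[j] x.length))
    (hthr : (Nb.eval x.length + Nat.sqrt^[j] x.length) ^ c ≤ (Nat.sqrt^[j] x.length) ^ d)
    (hmvn : mv.eval x.length ≤ Nb.eval x.length) (h7 : 7 ≤ Nb.eval x.length)
    (hqn : q.eval (2 * x.length + mv.eval x.length + mv.eval x.length) ≤ Nb.eval x.length)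
    (hrej : ∀ y : List.Vector Bool (mv.eval x.length),
      uniformProb (mv.eval x.length) {z | boolPair x (encMoves [y.toList, z]) ∈ Ref} ≤ 1 / 3)
    (u : List Bool) :
    verdictBit G Ref F mv Nb c sx j (boolPair x (G.adv (Nat.sqrt^[j] x.length))) u = false := by
  set m := Nat.sqrt^[j] x.length with hm
  set w := boolPair x (G.adv m) with hw
  have hfst : fstF w = x := fstF_boolPair _ _
  have hsnd : sndF w = G.adv m := sndF_boolPair _ _
  rw [verdictBit]
  simp only [hfst, hsnd]
  cases hgen : G.gen (Nat.sqrt^[j] x.length) (G.adv m) (guessOf G mv j w u) with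
  | none => rfl
  | some t =>
    simp only [decide_eq_false_iff_not, not_lt]
    -- `t` is generated, hence hard
    have ht : t ∈ G.outputs m := by
      refine ⟨guessOf G mv j w u, ?_, hgen⟩
      have := length_guessOf_le G mv j w u
      rwa [hfst] at this
    set y := msgOf G mv j w u with hy
    have hylen : y.length = mv.eval x.length := by rw [hy, length_msgOf, hfst]
    obtain ⟨C, hB, hs, hC⟩ := hq x y (mv.eval x.length) (Nb.eval x.length) hmvn
    have hsz : C.size ≤ Nb.eval x.length := hs.trans (by rw [hylen]; exact hqn)
    have habs := abs_accCount_sub_le h11 x y t hhard ht hthr hmvn C hB hsz hC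
    have hPr := hrej ⟨y, hylen⟩
    simp only [List.Vector.toList_mk] at hPr
    have hlt : (accCount Ref F mv Nb c sx j x y t : ℝ) / 2 ^ seedLen c sx j x.length < 1 / 2 :=
      lt_half_of_abs_sub_le habs hPr (one_div_lt_one_sixth h7)
    by_contra hle
    have hle' : 2 ^ seedLen c sx j x.length < 2 * accCount Ref F mv Nb c sx j x y t := not_le.1 hle
    rw [two_pow_lt_two_mul_iff] at hle'
    linarith

/-- **Completeness at a good length**: if some message `y` of Merlin is accepted with probability `≥ 2/3`
then the honest witness `⟨y, g₀⟩` (`g₀` an accepting guess of the generator with its designated advice),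
which is kept whole, makes the verifier accept `⟨x, adv m⟩`.
[cite: ImpagliazzoKabanetsWigderson2002, Thm. 12 (proof)] -/
theorem verdictBit_eq_true
    (h11 : ∀ (m n : ℕ) (f : (Fin m → Bool) → Bool), (n + m) ^ c < circuitSizeOver B2 f →
      IsSizePseudorandom (tableGenerator F f (c * m ^ sx) n))
    {q : Polynomial ℕ}
    (hq : ∀ (x y : List Bool) (m' N' : ℕ) (hmN : m' ≤ N'),
      ∃ C : Circuit (Fin N'), C.IsOver B2 ∧ C.size ≤ q.eval (2 * x.length + y.length + m') ∧
        ∀ r, C.eval r = Ref.boolIndicator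
          (boolPair x (encMoves [y, List.ofFn fun i : Fin m' => r (Fin.castLE hmN i)])))
    (x : List Bool) {d : ℕ} (hhard : G.HardAt ((Nat.sqrt^[j] x.length) ^ d) (Nat.sqrt^[j] x.length))
    (hthr : (Nb.eval x.length + Nat.sqrt^[j] x.length) ^ c ≤ (Nat.sqrt^[j] x.length) ^ d)
    (hmvn : mv.eval x.length ≤ Nb.eval x.length) (h7 : 7 ≤ Nb.eval x.length)
    (hqn : q.eval (2 * x.length + mv.eval x.length + mv.eval x.length) ≤ Nb.eval x.length)
    (y : List.Vector Bool (mv.eval x.length))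
    (hacc : 2 / 3 ≤ uniformProb (mv.eval x.length) {z | boolPair x (encMoves [y.toList, z]) ∈ Ref})
    {g₀ t₀ : List Bool} (hg₀ : g₀.length ≤ G.c * 2 ^ (G.c * Nat.sqrt^[j] x.length) + G.c)
    (hgen : G.gen (Nat.sqrt^[j] x.length) (G.adv (Nat.sqrt^[j] x.length)) g₀ = some t₀) :
    verdictBit G Ref F mv Nb c sx j (boolPair x (G.adv (Nat.sqrt^[j] x.length))) (boolPair y.toList g₀) = true := by
  set m := Nat.sqrt^[j] x.length with hm
  set w := boolPair x (G.adv m) with hw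
  set u := boolPair y.toList g₀ with hu
  have hfst : fstF w = x := fstF_boolPair _ _
  have hsnd : sndF w = G.adv m := sndF_boolPair _ _
  -- the honest witness is kept whole
  have hU : u.length ≤ keptLen mv G.c j x.length := by
    simp only [hu, length_boolPair, List.Vector.toList_length, keptLen, eval_add, eval_mul, eval_ofNat]
    rw [← hm]
    omega
  have htake : u.take (keptLen mv G.c j (fstF w).length) = u := by
    rw [hfst]; exact List.take_of_length_le hU
  have hguess : guessOf G mv j w u = g₀ := by
    rw [guessOf, htake]
    simp only [hu, sndF_boolPair, hfst]
    rw [← hm]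
    exact List.take_of_length_le hg₀
  have hmsg : msgOf G mv j w u = y.toList := by
    rw [msgOf, htake]
    simp only [hu, fstF_boolPair, hfst]
    rw [List.takeD_eq_take _ (by simp), List.take_of_length_le (by simp)]
  rw [verdictBit]
  simp only [hfst, hsnd, hguess, hmsg]
  rw [← hm, hgen]
  simp only [decide_eq_true_eq]
  have ht : t₀ ∈ G.outputs m := ⟨g₀, hg₀, hgen⟩
  obtain ⟨C, hB, hs, hC⟩ := hq x y.toList (mv.eval x.length) (Nb.eval x.length) hmvn
  have hsz : C.size ≤ Nb.eval x.length := hs.trans (by rw [List.Vector.toList_length]; exact hqn)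
  have habs := abs_accCount_sub_le h11 x y.toList t₀ hhard ht hthr hmvn C hB hsz hC
  have hgt : (1 : ℝ) / 2 < (accCount Ref F mv Nb c sx j x y.toList t₀ : ℝ) / 2 ^ seedLen c sx j x.length :=
    half_lt_of_abs_sub_le habs hacc (one_div_lt_one_sixth h7)
  rwa [two_pow_lt_two_mul_iff]

end Correct

/-! ### IKW Theorem 12 (2) from the discrete Theorem 11 -/

section Assembly

variable {a : ℕ → ℕ}

/-- The kept witness length is within the time budget shape: `keptLen ≤ K (2^{(c+c_G)m^{sx}} + N)^K + K`.
[folklore] -/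
theorem exists_keptLen_le (G : TruthTableGenerator a) (mv : Polynomial ℕ) (c sx j : ℕ) (hsx : 1 ≤ sx) :
    ∃ K : ℕ, ∀ N : ℕ, keptLen mv G.c j N ≤ K * (2 ^ ((c + G.c) * (Nat.sqrt^[j] N) ^ sx) + N) ^ K + K := by
  obtain ⟨A, hA⟩ := EasyWitness.exists_const_eval_le (2 * mv + 2)
  refine ⟨A + 2 * G.c + 1, fun N => ?_⟩
  set m := Nat.sqrt^[j] N with hm
  set Y := 2 ^ ((c + G.c) * m ^ sx) + N with hY
  have hY1 : 1 ≤ Y := le_add_right Nat.one_le_two_pow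
  have h1 : (2 * mv + 2).eval N ≤ A * Y ^ A + A :=
    (TM2Iter.eval_mono _ (Nat.le_add_left N _)).trans (hA Y hY1)
  have h2 : 2 ^ (G.c * m) ≤ Y :=
    (Nat.pow_le_pow_right (by norm_num) (gExp_le_expo c G.c sx hsx m)).trans (Nat.le_add_right _ _)
  have h3 : G.c * 2 ^ (G.c * m) ≤ G.c * Y := Nat.mul_le_mul_left _ h2
  have hYK : Y ≤ Y ^ (A + 2 * G.c + 1) := by
    calc Y = Y ^ 1 := (pow_one Y).symm
      _ ≤ Y ^ (A + 2 * G.c + 1) := Nat.pow_le_pow_right hY1 (by omega)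
  have hYA : Y ^ A ≤ Y ^ (A + 2 * G.c + 1) := Nat.pow_le_pow_right hY1 (by omega)
  simp only [keptLen]
  nlinarith [h1, h3, hYK, hYA]

/-- **IKW 2002, Thm. 12 (2), from the discrete Theorem 11.** If there are `F ∈ FP` and `c` such that for
all `m, n` and every `f : {0,1}^m → {0,1}` of circuit complexity `> (n + m)^c` the generator
`s ↦ F⟨tt f, ⟨1ⁿ, s⟩⟩↾n` on `c·m^{sx}` seed bits (`sx ≥ 1`) is `SIZE(n)`-pseudorandom (the reading of IKW's
Thm. 11 = [BFNW93, KM99] recorded in `HardnessVsRandomness.lean` with `sx = 2`, to be proved — with the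
tree's algebraic designs, `sx = 4` — inline), then `IKW2002_thm12_2` holds:
a nondeterministic `poly(2ⁿ)`-time generator with advice `a(n)` (monotone `a`) whose tables are
superpolynomially hard infinitely often gives `MA ⊆ io-[NTIME(2^{N^ε})/a(N^ε)]` for every `ε > 0`.
Proof (the printed "Theorem 11 readily implies the following", after Goldreich–Zuckerman): for
`L ∈ MA` with referee `Ref ∈ P` and move length `mv`, take Arthur's circuits (`MATests.exists_circuit`,
size polynomial `q`), the output length `Nb = q(2N + 2mv) + mv + 7`, the root depth `j` with
`sx·2^{-j} < ε`, and the verifier of `exists_verifier` at these data; its language `simLang` is in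
`NTIME(2^{⌈M^ε⌉₊})` (`exists_simLang_mem_NTIME`) and, with the advice `N ↦ adv(m(N))` of length
`≤ c_G a(m(N)) + c_G ≤ c_G a(⌈N^ε⌉₊) + c_G` (`a` monotone, `m(N) ≤ ⌈N^ε⌉₊`), defines a language of
`io`'s inner class; at the infinitely many lengths `N` whose scale `m(N)` is `d`-hard
(`HardIO`, transported by `frequently_comp_of_monotone_surjective`) and large, soundness
(`verdictBit_eq_false`) and completeness (`verdictBit_eq_true`, the honest witness being admissible by
`exists_keptLen_le` and the cost bound) give agreement with `L`.
[cite: ImpagliazzoKabanetsWigderson2002, Thm. 12 (2)] -/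
theorem IKW2002_thm12_2_of_thm11
    (h11 : ∃ F : List Bool → List Bool, F ∈ FP ∧ ∃ c sx : ℕ, 1 ≤ sx ∧ ∀ (m n : ℕ) (f : (Fin m → Bool) → Bool),
      (n + m) ^ c < circuitSizeOver B2 f → IsSizePseudorandom (tableGenerator F f (c * m ^ sx) n)) :
    IKW2002_thm12_2 := by
  intro a ha G hG ε hε L hL
  obtain ⟨F, hF, c, sx, hsx, h11⟩ := h11
  obtain ⟨Ref, hRef, mv, hL⟩ := mem_MA_iff.1 hL
  obtain ⟨q, hq⟩ := MATests.exists_circuit hRef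
  -- the root depth: `sx · 2^{-j} < ε`
  obtain ⟨j, hjε⟩ := exists_root_depth sx hε
  have hjε' : (1 / 2 : ℝ) ^ j ≤ ε := by
    have h0 : (0 : ℝ) ≤ (1 / 2 : ℝ) ^ j := by positivity
    have h1 : (1 : ℝ) ≤ sx := by exact_mod_cast hsx
    nlinarith
  -- the output length
  set Nb : Polynomial ℕ := q.comp (2 * X + 2 * mv) + mv + 7 with hNb
  have hNb_eval : ∀ N, Nb.eval N = q.eval (2 * N + 2 * mv.eval N) + mv.eval N + 7 := by
    intro N; simp [hNb]
  -- the machine and its language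
  obtain ⟨C₀, hC₀1, hC₀⟩ := exists_simLang_mem_NTIME (G := G) (Ref := Ref) (F := F) mv Nb c sx j hsx hRef hF hjε
  set t : ℕ → ℕ := fun M => 2 ^ ⌈(M : ℝ) ^ ε⌉₊ with ht
  set L₂ := simLang G Ref F mv Nb c sx j C₀ ε with hL₂
  set advice' : ℕ → List Bool := fun N => G.adv (Nat.sqrt^[j] N) with hadv
  set L₁ : Language Bool := {x | boolPair x (advice' x.length) ∈ L₂} with hL₁
  refine ⟨L₁, ⟨L₂, hC₀, G.c, advice', fun N => ?_, fun x => Iff.rfl⟩, ?_⟩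
  · -- advice length: `|adv (m N)| ≤ c_G a(m N) + c_G ≤ c_G a(⌈N^ε⌉₊) + c_G`
    exact (G.length_adv _).trans (Nat.add_le_add_right
      (Nat.mul_le_mul_left _ (ha (iterate_sqrt_le_ceil_rpow hjε' N))) _)
  -- the good lengths
  obtain ⟨d, hd⟩ := exists_pow_le_iterate_sqrt_pow Nb j c
  obtain ⟨K, hK⟩ := exists_keptLen_le G mv c sx j hsx
  have hcost := eventually_cost_pow_le_two_pow_ceil_rpow K (c + G.c) sx j hjε
  have hhardio : ∃ᶠ N in atTop, G.HardAt ((Nat.sqrt^[j] N) ^ d) (Nat.sqrt^[j] N) :=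
    frequently_comp_of_monotone_surjective (monotone_iterate_sqrt j) (surjective_iterate_sqrt j) (hG d)
  have hgood := hhardio.and_eventually (hd.and hcost)
  refine hgood.mono ?_
  rintro N ⟨hhard, hthr, hcostN⟩ x rfl
  -- the parameters at this length
  have hmvn : mv.eval x.length ≤ Nb.eval x.length := by rw [hNb_eval]; omega
  have h7 : 7 ≤ Nb.eval x.length := by rw [hNb_eval]; omega
  have hqn : q.eval (2 * x.length + mv.eval x.length + mv.eval x.length) ≤ Nb.eval x.length := by
    rw [hNb_eval, show 2 * x.length + mv.eval x.length + mv.eval x.length = 2 * x.length + 2 * mv.eval x.length by ring]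
    omega
  have hwL₁ : x ∈ L₁ ↔ boolPair x (G.adv (Nat.sqrt^[j] x.length)) ∈ L₂ := Iff.rfl
  obtain ⟨hyes, hno⟩ := hL x
  constructor
  · -- completeness
    intro hx
    obtain ⟨y, hy⟩ := exists_le_uniformProb_of_le_amValue (hyes hx)
    obtain ⟨g₀, hg₀, hsome⟩ := G.exists_isSome (Nat.sqrt^[j] x.length)
    obtain ⟨t₀, ht₀⟩ := Option.isSome_iff_exists.1 hsome
    rw [hwL₁]
    refine ⟨boolPair y.toList g₀, ?_, verdictBit_eq_true h11 hq x hhard hthr hmvn h7 hqn y hy hg₀ ht₀⟩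
    -- admissibility of the honest witness
    have h1 : (boolPair y.toList g₀).length ≤ keptLen mv G.c j x.length := by
      simp only [length_boolPair, List.Vector.toList_length, keptLen, eval_add, eval_mul, eval_ofNat]
      omega
    have h2 := (hK x.length).trans hcostN
    have h3 : 2 ^ ⌈((x.length : ℕ) : ℝ) ^ ε⌉₊ ≤
        2 ^ ⌈(((boolPair x (G.adv (Nat.sqrt^[j] x.length))).length : ℕ) : ℝ) ^ ε⌉₊ := by
      apply Nat.pow_le_pow_right (by norm_num)
      apply Nat.ceil_mono
      apply Real.rpow_le_rpow (Nat.cast_nonneg _) _ hε.le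
      exact_mod_cast (show x.length ≤ (boolPair x (G.adv (Nat.sqrt^[j] x.length))).length by
        rw [length_boolPair]; omega)
    nlinarith [h1, h2, h3, hC₀1]
  · -- soundness
    intro hx1
    by_contra hx
    rw [hwL₁] at hx1
    obtain ⟨u, -, hu⟩ := hx1
    have := verdictBit_eq_false h11 hq x hhard hthr hmvn h7 hqn
      (forall_uniformProb_le_of_amValue_le (hno hx)) u
    rw [this] at hu
    exact Bool.false_ne_true hu

end Assembly

end IKWSim

/-- **IKW 2002, Thm. 12 (2), from the discrete Theorem 11** (root-namespace alias of
`IKWSim.IKW2002_thm12_2_of_thm11`): if there are `F ∈ FP` and `c` such that for all `m, n` and every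
`f : {0,1}^m → {0,1}` of circuit complexity `> (n + m)^c` the generator `s ↦ F⟨tt f, ⟨1ⁿ, s⟩⟩↾n` on `c·m^{sx}`
seed bits (`sx ≥ 1`) is `SIZE(n)`-pseudorandom, then `IKW2002_thm12_2` holds.
[cite: ImpagliazzoKabanetsWigderson2002, Thm. 12 (2)] -/
theorem IKW2002_thm12_2_of_thm11
    (h11 : ∃ F : List Bool → List Bool, F ∈ FP ∧ ∃ c sx : ℕ, 1 ≤ sx ∧ ∀ (m n : ℕ) (f : (Fin m → Bool) → Bool),
      (n + m) ^ c < circuitSizeOver B2 f → IsSizePseudorandom (tableGenerator F f (c * m ^ sx) n)) :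
    IKW2002_thm12_2 :=
  IKWSim.IKW2002_thm12_2_of_thm11 h11

/-- **The discrete Theorem 11 of IKW (= [BFNW93, KM99]) in the tree's terms, proved**: there are a
polynomial-time `F` and `c` such that for all `m, n` and every `f : {0,1}^m → {0,1}` with
`circuitSizeOver B2 f > (n + m)^c`, the generator `s ↦ F⟨tt f, ⟨1ⁿ, s⟩⟩↾n` on `c · m⁴` seed bits is
`SIZE(n)`-pseudorandom (`F` = the machine of `IKWGenMachine.lean`, computing `IKWGen.genPad`; pseudorandomness
by `IKWGen.exists_hardness_exponent`). The record in `HardnessVsRandomness.lean` states the seed `c · m²`,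
which needs designs over a linear universe; the tree's polynomial designs give `m⁴`, which Theorem 12 consumes
equally. [cite: ImpagliazzoKabanetsWigderson2002, Thm. 11] -/
theorem IKW2002_thm11_tableGenerator :
    ∃ F : List Bool → List Bool, F ∈ FP ∧ ∃ c sx : ℕ, 1 ≤ sx ∧ ∀ (m n : ℕ) (f : (Fin m → Bool) → Bool),
      (n + m) ^ c < circuitSizeOver B2 f → IsSizePseudorandom (tableGenerator F f (c * m ^ sx) n) := by
  obtain ⟨F, hF, hFv⟩ := IKWGenM.exists_FP_tableGenerator_eq_genPad
  obtain ⟨c₀, -, h⟩ := IKWGen.exists_hardness_exponent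
  exact ⟨F, hF, c₀, 4, by norm_num, fun m n f hf => by rw [hFv f (c₀ * m ^ 4) n]; exact h m n f hf⟩

/-- **Impagliazzo–Kabanets–Wigderson 2002, Theorem 12 (2)** ("Suppose there is a poly(2ⁿ)-time
nondeterministic algorithm that, given advice of length `a(n)`, generates `2ⁿ`-bit truth tables of
`n`-variable Boolean functions … of circuit complexity `n^{ω(1)}` i.o.; then
`MA ⊆ ⋂_{ε>0} io-[NTIME(2^{n^ε})/a(n^ε)]`) — the discharge of the named fact `IKW2002_thm12_2` of
`IKWGenerators.lean`: the Goldreich–Zuckerman nondeterministic simulation of `MA` (`IKWSimulationMachine.lean`,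
`IKW2002_thm12_2_of_thm11`) armed with the generator of Theorem 11 (`IKW2002_thm11_tableGenerator`).
[cite: ImpagliazzoKabanetsWigderson2002, Thm. 12 (2)] -/
theorem IKW2002_thm12_2_holds : IKW2002_thm12_2 :=
  IKW2002_thm12_2_of_thm11 IKW2002_thm11_tableGenerator

end Literature.Computability.Complexity

end
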